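import Literature.AlgebraicGeometry.HodgeTheory.FermatHodgeCharacterQuadTop
import HarnessLib

/-!
# Cancellation of an Euler factor against a pair (Aoki 1983, Prop. 8.4 for `ℓ = 4`, Lemma 8.6)

Support file XIII (everything PROVED; no named facts, no definitions) for the structure theorem of
the Hodge characters of the Fermat surface (`AokiShioda1983_thmB2m_standard`).

At the levels `f ∣ m` below a prime `ℓ ∣ m` (`ℓ ∤ f`) the Hodge condition `(N_χ)` for the unit
entries carries the Euler factor `1 - χ̄(ℓ)`; so relations of the shape
`(1 - χ̄(ℓ))(1 - χ(w)) = 0` for all odd primitive `χ` mod `f` appear. `pair_cancel` removes the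
factor: `χ(w) = 1` for ALL odd primitive `χ` mod `f` (i.e. `w ∈ U(f)`), as soon as `f` has a
large prime (for [Aoki1983, Prop. 8.2], file `QuadTop`) and `ℓ, ℓ², -ℓ` are not in the
corresponding `U`-groups (true for `ℓ = 2, 3` and `f` large by [Aoki1983, Prop. 6.1]). This is
[Aoki1983, Prop. 8.4] for `ℓ(α) = 2` / Lemma 8.6 with `x = -ℓ⁻¹`, proved through the four points
`1, -w, -ℓ⁻¹, ℓ⁻¹ w`.

## References

* [Aoki1983] N. Aoki, On some arithmetic problems related to the Hodge cycles on the Fermat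
  varieties, Math. Ann. 266 (1983) 23–54, Prop. 8.4, Lemma 8.6 (text read).
-/

noncomputable section

open Finset

namespace Literature.AlgebraicGeometry.HodgeTheory

namespace FermatCharacter

/-- **Pair cancellation.** Let `f` be odd or divisible by `4` with a prime factor `p ≥ 11`, or
`p ∈ {5, 7}` with `p² ∣ f`; let `ℓ, w ∈ (ℤ/f)ˣ` with `(1 - χ(ℓ)⁻¹)(1 - χ(w)) = 0` for every odd
primitive `χ` mod `f`. Assume that some odd primitive character is `≠ 1` at `ℓ`, some is `≠ 1`
at `ℓ²`, and — when `5 ∥ f` — some odd primitive character mod `f/5` is `≠ 1` at `-ℓ`. Then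
`χ(w) = 1` for every odd primitive `χ` mod `f`. [cite: Aoki1983, Prop. 8.4 / Lemma 8.6] -/
theorem pair_cancel {f : ℕ} [NeZero f] (hval : Odd f ∨ 4 ∣ f) {p : ℕ} (hp : p.Prime)
    (hpf : p ∣ f) (hbig : 11 ≤ p ∨ (5 ≤ p ∧ p ^ 2 ∣ f)) (ℓ w : (ZMod f)ˣ)
    (h : ∀ χ : DirichletCharacter ℂ f, χ.Odd → χ.IsPrimitive → (1 - (χ ℓ)⁻¹) * (1 - χ w) = 0)
    (hℓ1 : ∃ χ : DirichletCharacter ℂ f, χ.Odd ∧ χ.IsPrimitive ∧ χ ℓ ≠ 1)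
    (hℓ2 : ∃ χ : DirichletCharacter ℂ f, χ.Odd ∧ χ.IsPrimitive ∧ (χ ℓ) ^ 2 ≠ 1)
    (hℓ5 : ∀ f₅ : ℕ, f = 5 * f₅ → ¬ 5 ∣ f₅ → ∀ hd5 : f₅ ∣ f,
      ∃ χ : DirichletCharacter ℂ f₅, χ.Odd ∧ χ.IsPrimitive ∧
        χ (ZMod.castHom hd5 (ZMod f₅) ((-ℓ : (ZMod f)ˣ) : ZMod f)) ≠ 1)
    (χ : DirichletCharacter ℂ f) (hodd : χ.Odd) (hχ : χ.IsPrimitive) : χ w = 1 := by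
  classical
  -- the four points `1, -w, -ℓ⁻¹, ℓ⁻¹ w`
  set x : Fin 4 → (ZMod f)ˣ := ![1, -w, -ℓ⁻¹, ℓ⁻¹ * w] with hx
  have hx0 : x 0 = 1 := rfl
  have hx1 : x 1 = -w := rfl
  have hx2 : x 2 = -ℓ⁻¹ := rfl
  have hx3 : x 3 = ℓ⁻¹ * w := rfl
  have hv0 : ∀ ψ : DirichletCharacter ℂ f, ψ (x 0) = 1 := fun ψ ↦ by rw [hx0, Units.val_one, map_one]
  have hv1 : ∀ ψ : DirichletCharacter ℂ f, ψ.Odd → ψ (x 1) = -ψ w := fun ψ hψ ↦ by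
    rw [hx1, Units.val_neg, hψ.eval_neg]
  have hv2 : ∀ ψ : DirichletCharacter ℂ f, ψ.Odd → ψ (x 2) = -(ψ ℓ)⁻¹ := fun ψ hψ ↦ by
    rw [hx2, Units.val_neg, hψ.eval_neg, map_units_inv]
  have hv3 : ∀ ψ : DirichletCharacter ℂ f, ψ (x 3) = (ψ ℓ)⁻¹ * ψ w := fun ψ ↦ by
    rw [hx3, Units.val_mul, map_mul, map_units_inv]
  have hT : ∀ ψ : DirichletCharacter ℂ f, ψ.Odd → ψ.IsPrimitive → ∑ i, ψ (x i) = 0 := by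
    intro ψ hψ hψp
    rw [Fin.sum_univ_four, hv0, hv1 ψ hψ, hv2 ψ hψ, hv3]
    linear_combination h ψ hψ hψp
  rcases quad_odd_level hval hp hpf hbig x hT with
    ⟨i, j, k, l, n1, n2, n3, n4, n5, n6, P1, P2⟩ | ⟨f₅, hf, h5, H⟩
  · -- normalise the splitting so that the first pair contains `0`
    obtain ⟨t, a, b, ht, hab, hta, htb, ha, hb, Q1, Q2⟩ : ∃ t a b : Fin 4, t ≠ 0 ∧ a ≠ b ∧ t ≠ a ∧
        t ≠ b ∧ a ≠ 0 ∧ b ≠ 0 ∧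
        (∀ ψ : DirichletCharacter ℂ f, ψ.Odd → ψ.IsPrimitive → ψ (x 0) + ψ (x t) = 0) ∧
        (∀ ψ : DirichletCharacter ℂ f, ψ.Odd → ψ.IsPrimitive → ψ (x a) + ψ (x b) = 0) := by
      have cover : i = 0 ∨ j = 0 ∨ k = 0 ∨ l = 0 := by
        have key : ∀ i j k l : Fin 4, i ≠ j → i ≠ k → i ≠ l → j ≠ k → j ≠ l → k ≠ l →
            (i = 0 ∨ j = 0 ∨ k = 0 ∨ l = 0) := by decide
        exact key i j k l n1 n2 n3 n4 n5 n6
      rcases cover with rfl | rfl | rfl | rfl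
      · exact ⟨j, k, l, n1.symm, n6, n4, n5, n2.symm, n3.symm, P1, P2⟩
      · exact ⟨i, k, l, n1, n6, n2, n3, n4.symm, n5.symm,
          fun ψ hψ hp' ↦ by rw [add_comm]; exact P1 ψ hψ hp', P2⟩
      · exact ⟨l, i, j, n6.symm, n1, n3.symm, n5.symm, n2, n4, P2, P1⟩
      · exact ⟨k, i, j, n6, n1, n2.symm, n4.symm, n3, n5,
          fun ψ hψ hp' ↦ by rw [add_comm]; exact P2 ψ hψ hp', P1⟩
    have ht' : t = 1 ∨ t = 2 ∨ t = 3 := by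
      have key : ∀ t : Fin 4, t ≠ 0 → t = 1 ∨ t = 2 ∨ t = 3 := by decide
      exact key t ht
    rcases ht' with rfl | rfl | rfl
    · -- `[1] + [-w]` annihilated: `χ(w) = 1`
      have := Q1 χ hodd hχ
      rw [hv0, hv1 χ hodd] at this
      linear_combination -this
    · -- `[1] + [-ℓ⁻¹]` annihilated: `ℓ ∈ U(f)`, excluded
      exfalso
      obtain ⟨ψ, hψ, hψp, hne⟩ := hℓ1
      have := Q1 ψ hψ hψp
      rw [hv0, hv2 ψ hψ] at this
      apply hne
      have hu : (ψ ℓ)⁻¹ = 1 := by linear_combination -this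
      rw [← inv_inv (ψ ℓ), hu, inv_one]
    · -- `[1] + [ℓ⁻¹ w]` and `[-w] + [-ℓ⁻¹]` annihilated: `ℓ² ∈ U(f)`, excluded
      exfalso
      have hab' : (a = 1 ∧ b = 2) ∨ (a = 2 ∧ b = 1) := by
        have key : ∀ a b : Fin 4, a ≠ b → (3 : Fin 4) ≠ a → (3 : Fin 4) ≠ b → a ≠ 0 → b ≠ 0 →
            (a = 1 ∧ b = 2) ∨ (a = 2 ∧ b = 1) := by decide
        exact key a b hab hta htb ha hb
      have Q2' : ∀ ψ : DirichletCharacter ℂ f, ψ.Odd → ψ.IsPrimitive → ψ (x 1) + ψ (x 2) = 0 := by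
        rcases hab' with ⟨rfl, rfl⟩ | ⟨rfl, rfl⟩
        · exact Q2
        · exact fun ψ hψ hp' ↦ by rw [add_comm]; exact Q2 ψ hψ hp'
      obtain ⟨ψ, hψ, hψp, hne⟩ := hℓ2
      have e1 := Q1 ψ hψ hψp
      have e2 := Q2' ψ hψ hψp
      rw [hv0, hv3] at e1
      rw [hv1 ψ hψ, hv2 ψ hψ] at e2
      apply hne
      have hw : ψ w = -(ψ ℓ)⁻¹ := by linear_combination -e2
      rw [hw] at e1
      have hne0 : ψ ℓ ≠ 0 := fun h0 ↦ by
        have := DirichletCharacter.unit_norm_eq_one ψ ℓ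
        rw [h0, norm_zero] at this; exact zero_ne_one this
      field_simp at e1
      linear_combination e1
  · -- the `5`-quasi-standard case: `-ℓ ∈ U(f/5)`, excluded
    exfalso
    haveI : NeZero f₅ := ⟨fun h0 ↦ NeZero.ne f (by rw [hf, h0, mul_zero])⟩
    have hd5 : f₅ ∣ f := ⟨5, by rw [hf, mul_comm]⟩
    obtain ⟨ψ, hψ, hψp, hne⟩ := hℓ5 f₅ hf h5 hd5
    have e := H hd5 ψ hψ hψp 0 2
    rw [hx0, hx2, Units.val_one, map_one, map_one] at e
    apply hne
    have hprod : ((-ℓ : (ZMod f)ˣ) : ZMod f) * ((-ℓ⁻¹ : (ZMod f)ˣ) : ZMod f) = 1 := by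
      rw [← Units.val_mul, neg_mul_neg, mul_inv_cancel, Units.val_one]
    have := congrArg (fun z ↦ ψ (ZMod.castHom hd5 (ZMod f₅) z)) hprod
    simp only [map_mul, map_one] at this
    rw [← e, mul_one] at this
    exact this

end FermatCharacter

end Literature.AlgebraicGeometry.HodgeTheory
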